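/-
Copyright (c) 2026 the pub-hodgecm-mathlib formalisation cell (harness21).  Prover seat hodgecm-mathlib-F0P3a-p03 (g14), 2026-09-01.  Road «S3-tree» (census «S3» v2
8d373588 §4 (R-T), architect A-p16 (g28)), brick T6-1u (CENSUS-T6 4cc46265 §4): the STABLE (two-sheet) depth expansion of an orbital integral on `H_v = U(Φ₂)(L⁺_v) × U(Φ₁)(L⁺_v)`
along an elliptic torus at an INERT place — the `+`-sign twin of ★ (β) `depthExpansion_pair_selfDual ∕ _modular` (road «R1LL-tree»).
-/
import Literature.NumberTheory.Rogawski1990.RankOneUnstableTransferInertCoreClosed   -- ★ p843756 (β) HEAD ED. 2: `depthExpansion_pair_selfDual`, `depthExpansion_pair_modular` (+ ★ S4 «P-FLIP», ★ asm, ★ (α) A-13 (a))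
import HarnessLib

/-!
# The STABLE depth expansion `O_ν(↑t, φ) + O_ν(e ↑t, φ)` along an elliptic torus of `H_v = U(Φ₂)(L⁺_v) × U(Φ₁)(L⁺_v)` at an inert place: the two sheets of
# ★ A-13 (a) add up to the FULL ball ∕ shell sums — the `H`-side of the unit fundamental lemma read as a germ
# (Rogawski 1990 §4.9 Lemma 4.9.3 p. 56, Prop. 8.1.1 p. 112; Labesse–Langlands 1979 §2, §5; Kottwitz 1988 §2)

Topic `NumberTheory/Rogawski1990`; namespace `Literature.NumberTheory.Rogawski1990`.  THEOREMS ONLY (no definition, no instance, no notation, no named fact, no `sorry`);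
kernel lane `--supports stmt-HodgeConjecture-24833`.  Cell `pub/hodgecm-mathlib` (D-0151), crux H413, line «N6nsGerm» last stub `stub_N6nsS3id` (S3 at the identity); road
«S3-tree» brick **T6-1u** = row (1)-inert of the H-side germ table (CENSUS-T6 `F0/P3a/F0P3a-p03/g14/CENSUS-T6-HsideRealisability.F0P3a-p03g14.md` §2∕§4).  HONEST LABEL: HC_CM is
proved only modulo the printed citations (2 remaining named inputs hLiu418 24832, h413 24833) until rung 0 closes; this file is bookkeeping over ★ material and asserts nothing printed.

THE MATHEMATICS.  ★ (β) `depthExpansion_pair_selfDual` (resp. `_modular`) gives, for a piece `φ` supported in `K × U(Φ₁)_v` (`K ↔ K⁰` self-dual, resp. `K ↔ K¹` `ϖ`-modular,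
through the one-place model `E₂`), `Ad`-invariant there and right-`K_m`-invariant, and a regular `t` of depth `N ≥ m` on the elliptic torus `Z(t₀)` with its similitude partner
`e ↑t` (★ `exists_stablePartner_congr_uniformizer`: stably conjugate, not conjugate — the OTHER `H_v`-class of the stable class), the two orbital integrals as PARITY sums with
bits `b` and `1 − b`: `O_ν(↑t, φ) = ν(K × U(Φ₁)_v) • (Σ_{j ≤ N, j ≡ b, j + m ≤ N} w_j • φ(x_m) + Σ_{i<m} [i ≤ N ∧ N − i ≡ b] w_{N−i} • φ(x_i))` and the same with `1 − b` at
`e ↑t` (`w_0 = 1`, `w_j = q^{j−1}(q+1)` the sphere sizes of the tree of `SL₂(L⁺_v)`, `q = #(𝓞_{L⁺}∕v)`).  ADDING the two sheets kills the parity constraint: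
  **`O_ν(↑t, φ) + O_ν(e ↑t, φ) = ν(K × U(Φ₁)_v) • ((Σ_{j ≤ N−m} w_j) • φ(x_m) + Σ_{i<m} w_{N−i} • φ(x_i))`**
— the STABLE orbital integral of `φ` along `Z(t₀)` (the stable class of a regular `t` is `{⟦t⟧, ⟦e t⟧}`, ★ `RankOneTorusStablePartner`), with the ball count
`Σ_{j ≤ n} w_j = ((q+1)q^{n} − 2)∕(q − 1)` (§1): for `φ = 1_{K × U(Φ₁)_v}` (`m = 0`) this is `A₀ + B₀·q^{N}`, `(A₀, B₀) = (−2∕(q−1), (q+1)∕(q−1))` up to `ν(K × U(Φ₁)_v)`, and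
for a level-`m` piece vanishing at the shell points `x_i` (`i < m`) it is `A₀ + q^{−m}B₀·q^{N}` — the two-term stable germ `Γ₁^{st} + Γ_{reg}^{st}·|D_H|^{−1∕2}` of the rank-one group
[Rogawski1990 Prop. 8.1.1; LabesseLanglands1979 §5] in tree currency, with exactly the constants the road's numerical certificate S3-T0 found on the `G′ = U(3)_v` side for the
unit and level units (A-p12 (g20) cert 72374893 §5; F0P3b-p01 (g10) T0-ADDENDUM-1 (B)), as the unit fundamental lemma (★ p842433) predicts.

* §1 ALGEBRA (generic, any additive commutative monoid): `sum_filter_parity_add_sum_filter_parity_eq` (the two parity classes exhaust), `filter_range_succ_add_le_eq_range`,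
  **`paritySum_smul_add_paritySum_smul_eq`** (the two sheets' A-13 (a) sums add to the full sums), `cast_sub_one_mul_sum_weight_add_two` (`(q−1)·Σ_{j ≤ n} w_j + 2 = (q+1)q^n`),
  and the pieces version `sum_add_eq_depthExpansion_of_paritySums` (the `+`-twin of ★ `sum_sub_eq_depthExpansion_of_paritySums`).
* §2 ON `H_v` (inert `v`, binders of ★ (β) §3 VERBATIM): **`integral_conj_add_integral_conj_partner_eq_selfDual`**, **`integral_conj_add_integral_conj_partner_eq_modular`**.

## References
* [Rogawski1990] J. D. Rogawski, *Automorphic Representations of Unitary Groups in Three Variables*, Ann. of Math. Stud. 123 (1990): §4.9 Lemma 4.9.3 p. 56; §8.1 Prop. 8.1.1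
  p. 112 (germ expansion on the rank-one endoscopic group); §3.6 pp. 31–32.
* [LabesseLanglands1979] J.-P. Labesse, R. P. Langlands, *L-indistinguishability for SL(2)*, Canad. J. Math. 31 (1979): §2, §5.
* [Kottwitz1988] R. E. Kottwitz, *Tamagawa numbers*, Ann. of Math. 127 (1988): §2.
* [Serre1980Trees] J.-P. Serre, *Trees* (1980): Ch. II §1.1 (balls and spheres in the tree of `SL₂`).
-/

set_option autoImplicit false

noncomputable section

open Set Filter Topology MeasureTheory NumberField IsDedekindDomain Finset Matrix ValuativeRel Function MulAction
open scoped Matrix MatrixGroups ValuativeRel WithZero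

namespace Literature.NumberTheory.Rogawski1990

open Literature.NumberTheory.Automorphic Literature.NumberTheory.Automorphic.UnitaryGroup Literature.NumberTheory.GaloisRepresentations

/-! ## §1 Algebra: the two parity classes of the A-13 (a) sums add up to the full ball ∕ shell sums -/

section Algebra

/-- The two parity classes `j ≡ b` and `j ≡ 1 − b` (`b ≤ 1`) EXHAUST: the filtered sums add up to the sum over `p`. [cite: Serre1980Trees, Ch. II §1.1] -/
theorem sum_filter_parity_add_sum_filter_parity_eq {M : Type*} [AddCommMonoid M] (s : Finset ℕ) (p : ℕ → Prop) [DecidablePred p]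
    {b : ℕ} (hb : b ≤ 1) (f : ℕ → M) :
    ∑ j ∈ s.filter (fun j => j % 2 = b ∧ p j), f j + ∑ j ∈ s.filter (fun j => j % 2 = 1 - b ∧ p j), f j = ∑ j ∈ s.filter p, f j := by
  classical
  rw [← Finset.sum_union (Finset.disjoint_filter.2 fun j _ h1 h2 => by omega)]
  refine Finset.sum_congr ?_ fun _ _ => rfl
  rw [← Finset.filter_or]
  exact Finset.filter_congr fun j _ => ⟨fun h => h.elim And.right And.right, fun h => by
    rcases Nat.le_one_iff_eq_zero_or_eq_one.1 hb with rfl | rfl <;> rcases Nat.mod_two_eq_zero_or_one j with hj | hj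
    · exact Or.inl ⟨hj, h⟩
    · exact Or.inr ⟨hj, h⟩
    · exact Or.inr ⟨hj, h⟩
    · exact Or.inl ⟨hj, h⟩⟩

/-- For `m ≤ N`: `{j < N + 1 | j + m ≤ N} = {j < N − m + 1}`. [cite: Serre1980Trees, Ch. II §1.1] -/
theorem filter_range_succ_add_le_eq_range {m N : ℕ} (hmN : m ≤ N) :
    (Finset.range (N + 1)).filter (fun j => j + m ≤ N) = Finset.range (N - m + 1) := by
  ext j
  simp only [Finset.mem_filter, Finset.mem_range]
  omega

/-- **THE TWO SHEETS ADD UP.**  With A-p13's ★ level-`m` ball count `Σ_{j ≤ N, j ≡ b, j + m ≤ N} w_j` and exact-depth count `[i ≤ N ∧ N − i ≡ b]·w_{N−i}` at bit `b`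
(`w_0 = 1`, `w_j = q^{j−1}(q+1)`), the bit-`b` sum plus the bit-`(1 − b)` sum (same values `ψm`, `ψ i`) is the FULL sum `(Σ_{j ≤ N − m} w_j) • ψm + Σ_{i<m} w_{N−i} • ψ i`
(`m ≤ N`).  [cite: Rogawski1990, §4.9 Lemma 4.9.3 p. 56] [cite: LabesseLanglands1979, §2] -/
theorem paritySum_smul_add_paritySum_smul_eq {M : Type*} [AddCommMonoid M] (q : ℕ) {m N : ℕ} (hmN : m ≤ N) {b : ℕ} (hb : b ≤ 1) (ψm : M) (ψ : ℕ → M) :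
    ((∑ j ∈ (Finset.range (N + 1)).filter (fun j => j % 2 = b ∧ j + m ≤ N), (if j = 0 then 1 else q ^ (j - 1) * (q + 1))) • ψm +
        ∑ i ∈ Finset.range m, (if i ≤ N ∧ (N - i) % 2 = b then (if N - i = 0 then 1 else q ^ (N - i - 1) * (q + 1)) else 0) • ψ i) +
      ((∑ j ∈ (Finset.range (N + 1)).filter (fun j => j % 2 = 1 - b ∧ j + m ≤ N), (if j = 0 then 1 else q ^ (j - 1) * (q + 1))) • ψm +
        ∑ i ∈ Finset.range m, (if i ≤ N ∧ (N - i) % 2 = 1 - b then (if N - i = 0 then 1 else q ^ (N - i - 1) * (q + 1)) else 0) • ψ i) =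
      (∑ j ∈ Finset.range (N - m + 1), (if j = 0 then 1 else q ^ (j - 1) * (q + 1))) • ψm +
        ∑ i ∈ Finset.range m, (if N - i = 0 then 1 else q ^ (N - i - 1) * (q + 1)) • ψ i := by
  classical
  rw [add_add_add_comm, ← add_smul, sum_filter_parity_add_sum_filter_parity_eq _ _ hb, filter_range_succ_add_le_eq_range hmN,
    ← Finset.sum_add_distrib]
  congr 1
  refine Finset.sum_congr rfl fun i hi => ?_
  rw [← add_smul]
  congr 1
  have hiN : i ≤ N := (Finset.mem_range.1 hi).le.trans hmN
  rcases Nat.le_one_iff_eq_zero_or_eq_one.1 hb with rfl | rfl <;> rcases Nat.mod_two_eq_zero_or_one (N - i) with h | h <;>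
    simp [h, hiN]

/-- **THE BALL COUNT IN CLOSED FORM**: `(q − 1)·(Σ_{j ≤ n} w_j) + 2 = (q + 1)·q^n` (`w_0 = 1`, `w_j = q^{j−1}(q+1)`: `1 + (q+1)(1 + q + ⋯ + q^{n−1})` vertices in the ball of
radius `n` of the `(q+1)`-regular tree). [cite: Serre1980Trees, Ch. II §1.1] -/
theorem cast_sub_one_mul_sum_weight_add_two {R : Type*} [CommRing R] (q n : ℕ) :
    ((q : R) - 1) * (((∑ j ∈ Finset.range (n + 1), (if j = 0 then 1 else q ^ (j - 1) * (q + 1)) : ℕ) : R)) + 2 = ((q : R) + 1) * (q : R) ^ n := by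
  induction n with
  | zero => simp; ring
  | succ n ih =>
    rw [Finset.sum_range_succ, Nat.cast_add, mul_add, add_right_comm, ih, if_neg (Nat.succ_ne_zero n), Nat.add_sub_cancel]
    push_cast
    ring

/-- **THE PIECES VERSION** (the `+`-twin of ★ `sum_sub_eq_depthExpansion_of_paritySums`): finitely many pieces `k`, piece `k` contributing `O k = r_k • (bit-`e_k` sum)` at `↑t`
and `O′ k = r_k • (bit-`(1 − e_k)` sum)` at the partner; then `Σ_k (O k + O′ k) = (Σ_k r_k ψm_k) · (Σ_{j ≤ N−m} w_j) + Σ_{i<m} w_{N−i} · (Σ_k r_k ψ_k i)`.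
[cite: Rogawski1990, §4.9 Lemma 4.9.3 p. 56] [cite: LabesseLanglands1979, §2] -/
theorem sum_add_eq_depthExpansion_of_paritySums {ι : Type*} [Fintype ι] (q : ℕ) {m N : ℕ} (hmN : m ≤ N)
    (e : ι → ℕ) (he : ∀ k, e k ≤ 1) (r : ι → ℝ) (ψm : ι → ℂ) (ψ : ι → ℕ → ℂ) (O O' : ι → ℂ)
    (hO : ∀ k, O k = r k • ((∑ j ∈ (Finset.range (N + 1)).filter (fun j => j % 2 = e k ∧ j + m ≤ N), (if j = 0 then 1 else q ^ (j - 1) * (q + 1))) • ψm k +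
      ∑ i ∈ Finset.range m, (if i ≤ N ∧ (N - i) % 2 = e k then (if N - i = 0 then 1 else q ^ (N - i - 1) * (q + 1)) else 0) • ψ k i))
    (hO' : ∀ k, O' k = r k • ((∑ j ∈ (Finset.range (N + 1)).filter (fun j => j % 2 = 1 - e k ∧ j + m ≤ N), (if j = 0 then 1 else q ^ (j - 1) * (q + 1))) • ψm k +
      ∑ i ∈ Finset.range m, (if i ≤ N ∧ (N - i) % 2 = 1 - e k then (if N - i = 0 then 1 else q ^ (N - i - 1) * (q + 1)) else 0) • ψ k i)) :
    ∑ k, (O k + O' k) =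
      (∑ k, (r k : ℂ) * ψm k) * (((∑ j ∈ Finset.range (N - m + 1), (if j = 0 then 1 else q ^ (j - 1) * (q + 1))) : ℕ) : ℂ) +
        ∑ i ∈ Finset.range m, (((if N - i = 0 then 1 else q ^ (N - i - 1) * (q + 1) : ℕ)) : ℂ) * ∑ k, (r k : ℂ) * ψ k i := by
  have hk : ∀ k, O k + O' k = (r k : ℂ) * (ψm k * (((∑ j ∈ Finset.range (N - m + 1), (if j = 0 then 1 else q ^ (j - 1) * (q + 1))) : ℕ) : ℂ) +
      ∑ i ∈ Finset.range m, (((if N - i = 0 then 1 else q ^ (N - i - 1) * (q + 1) : ℕ)) : ℂ) * ψ k i) := by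
    intro k
    rw [hO k, hO' k, ← smul_add, paritySum_smul_add_paritySum_smul_eq q hmN (he k), Complex.real_smul, nsmul_eq_mul, mul_comm (_ : ℂ) (ψm k)]
    congr 2
    exact Finset.sum_congr rfl fun i _ => nsmul_eq_mul _ _
  rw [Finset.sum_congr rfl fun k _ => hk k]
  simp only [mul_add, Finset.sum_add_distrib, Finset.mul_sum, Finset.sum_mul]
  rw [Finset.sum_comm]
  congr 1
  · exact Finset.sum_congr rfl fun k _ => by ring
  · exact Finset.sum_congr rfl fun i _ => Finset.sum_congr rfl fun k _ => by ring

end Algebra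

/-! ## §2 On `H_v` at an inert place: the STABLE sum of the pair of expansions (binders of ★ (β) §3 verbatim) -/

section Pair

variable (L : Type) [Field L] [NumberField L] [IsCMField L] (v : HeightOneSpectrum (𝓞 ↥(maximalRealSubfield L)))
  (w : PlacesOver L v) (hw : IsCMField.complexConj L • w.1 = w.1) (hunr : Algebra.IsUnramifiedIn (𝓞 L) v.asIdeal)
  [MeasurableSpace ((cmDatum L 2 (Matrix.of fun i j : Fin 2 => if i.val + j.val + 1 = 2 then (1 : L) else 0)).Local v × (cmDatum L 1 (Matrix.of fun i j : Fin 1 => if i.val + j.val + 1 = 1 then (1 : L) else 0)).Local v)] [BorelSpace ((cmDatum L 2 (Matrix.of fun i j : Fin 2 => if i.val + j.val + 1 = 2 then (1 : L) else 0)).Local v × (cmDatum L 1 (Matrix.of fun i j : Fin 1 => if i.val + j.val + 1 = 1 then (1 : L) else 0)).Local v)] (ν : Measure ((cmDatum L 2 (Matrix.of fun i j : Fin 2 => if i.val + j.val + 1 = 2 then (1 : L) else 0)).Local v × (cmDatum L 1 (Matrix.of fun i j : Fin 1 => if i.val + j.val + 1 = 1 then (1 : L) else 0)).Local v)) [ν.IsHaarMeasure]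 [ν.IsMulRightInvariant]
  (t₀ : ((cmDatum L 2 (Matrix.of fun i j : Fin 2 => if i.val + j.val + 1 = 2 then (1 : L) else 0)).Local v × (cmDatum L 1 (Matrix.of fun i j : Fin 1 => if i.val + j.val + 1 = 1 then (1 : L) else 0)).Local v)) (P : GL (Fin 2) (LocalRing L v)) (d : Fin 2 → LocalRing L v) (ht₀ : IsRegularElt (t₀.1.val : GL (Fin 2) (LocalRing L v)))
  (hP : (t₀.1.val.val : Matrix (Fin 2) (Fin 2) (LocalRing L v)) * P.val = P.val * Matrix.diagonal d) (hd1 : ∀ i, conjLocal L (IsCMField.complexConj L) v (d i) * d i = 1)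

-- `L_w`-sized statement: elaboration budget only (no search)
set_option maxHeartbeats 1600000 in
include hw hunr ht₀ hP hd1 in
/-- **THE STABLE DEPTH EXPANSION, SELF-DUAL VERTEX TYPE (`ε = 0`).**  Binders of ★ `depthExpansion_pair_selfDual` VERBATIM (a piece `φ` supported in `K × U(Φ₁)_v`, `K ↔ K⁰`
through `E₂`, `Ad`-invariant there and right-`Km`-invariant at the one place; value points `xm`, `xs`; bit `b` of the torus frame; `t ∈ Z(t₀)` regular of depth `N t ≥ m`; `e` the
similitude partner): the orbital integrals at `↑t` and at `e ↑t` ADD UP to the full ball ∕ shell sums —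
`O_ν(↑t, φ) + O_ν(e ↑t, φ) = ν(K × U(Φ₁)_v) • ((Σ_{j ≤ N−m} w_j) • φ(E₂⁻¹(xm t), t.2) + Σ_{i<m} w_{N−i} • φ(E₂⁻¹(xs t i), t.2))`.  ★ pair ∘ §1.
[cite: Rogawski1990, §4.9 Lemma 4.9.3 p. 56; §8.1 Prop. 8.1.1 p. 112] [cite: LabesseLanglands1979, §2, §5] [cite: Kottwitz1988, §2] -/
theorem integral_conj_add_integral_conj_partner_eq_selfDual
    (σO : 𝒪[(w.1.adicCompletion L)] →+* 𝒪[(w.1.adicCompletion L)]) (hσO' : ∀ x : 𝒪[(w.1.adicCompletion L)], ((σO x : 𝒪[(w.1.adicCompletion L)]) : (w.1.adicCompletion L)) = (galAdicCompletionMap (L := L) (IsCMField.complexConj L) hw) x) (hσσ : ∀ x, σO (σO x) = x)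
    {a₀ : 𝒪[(w.1.adicCompletion L)]} (ha₀ : IsUnit (σO a₀ - a₀))
    (E₂ : (cmDatum L 2 (Matrix.of fun i j : Fin 2 => if i.val + j.val + 1 = 2 then (1 : L) else 0)).Local v ≃ₜ* ↥(unitaryGroupOfForm (galAdicCompletionMap (L := L) (IsCMField.complexConj L) hw) (placeForm (Matrix.of fun i j : Fin 2 => if i.val + j.val + 1 = 2 then (1 : L) else 0) w.1))) (hE₂ : ∀ g, ((E₂ g : ↥(unitaryGroupOfForm (galAdicCompletionMap (L := L) (IsCMField.complexConj L) hw) (placeForm (Matrix.of fun i j : Fin 2 => if i.val + j.val + 1 = 2 then (1 : L) else 0) w.1))) : GL (Fin 2) (w.1.adicCompletion L)) = ((localNonsplitEquiv (IsCMField.complexConj L) (Matrix.of fun i j : Fin 2 => if i.val + j.val + 1 = 2 then (1 : L) else 0) (IsCMField.complexConj_ne_one L) w hw g : ↥(unitaryGroupOfForm (galAdicCompletionMap (L := L) (IsCMField.complexConj L) hw) (placeForm (Matrix.of fun i j : Fin 2 => if i.val + j.val + 1 = 2 then (1 : L) else 0) w.1))) : GL (Fin 2) (w.1.adicCompletion 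L)))
    (hr₀ : IsUnit (toLocalRing L v (HeckeCharacter.uniformizer ↥(maximalRealSubfield L) v : v.adicCompletion ↥(maximalRealSubfield L)))) (e : ((cmDatum L 2 (Matrix.of fun i j : Fin 2 => if i.val + j.val + 1 = 2 then (1 : L) else 0)).Local v × (cmDatum L 1 (Matrix.of fun i j : Fin 1 => if i.val + j.val + 1 = 1 then (1 : L) else 0)).Local v) ≃ₜ* ((cmDatum L 2 (Matrix.of fun i j : Fin 2 => if i.val + j.val + 1 = 2 then (1 : L) else 0)).Local v × (cmDatum L 1 (Matrix.of fun i j : Fin 1 => if i.val + j.val + 1 = 1 then (1 : L) else 0)).Local v)) (he2 : ∀ a : ((cmDatum L 2 (Matrix.of fun i j : Fin 2 => if i.val + j.val + 1 = 2 then (1 : L) else 0)).Local v × (cmDatum L 1 (Matrix.of fun i j : Fin 1 => if i.val + j.val + 1 = 1 then (1 : L) else 0)).Local v), (e a).2 = a.2)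
    (heframe : ∀ t : ↥(Subgroup.centralizer ({t₀} : Set ((cmDatum L 2 (Matrix.of fun i j : Fin 2 => if i.val + j.val + 1 = 2 then (1 : L) else 0)).Local v × (cmDatum L 1 (Matrix.of fun i j : Fin 1 => if i.val + j.val + 1 = 1 then (1 : L) else 0)).Local v))), ((e (t : ((cmDatum L 2 (Matrix.of fun i j : Fin 2 => if i.val + j.val + 1 = 2 then (1 : L) else 0)).Local v × (cmDatum L 1 (Matrix.of fun i j : Fin 1 => if i.val + j.val + 1 = 1 then (1 : L) else 0)).Local v))).1.val.val : Matrix (Fin 2) (Fin 2) (LocalRing L v)) * ((glDiagonal 2 (LocalRing L v) ![1, hr₀.unit]) * P).val = ((glDiagonal 2 (LocalRing L v) ![1, hr₀.unit]) * P).val * Matrix.diagonal ![(((P⁻¹).val * ((t : ((cmDatum L 2 (Matrix.of fun i j : Fin 2 => if i.val + j.val + 1 = 2 then (1 : L) else 0)).Local v × (cmDatum L 1 (Matrix.of fun i j : Fin 1 => if i.val + j.val + 1 = 1 then (1 : L) else 0)).Local v)).1.val.val : Matrix (Fin 2) (Fin 2) (LocalRing L v)) * P.val) 0 0), (((P⁻¹).val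 * ((t : ((cmDatum L 2 (Matrix.of fun i j : Fin 2 => if i.val + j.val + 1 = 2 then (1 : L) else 0)).Local v × (cmDatum L 1 (Matrix.of fun i j : Fin 1 => if i.val + j.val + 1 = 1 then (1 : L) else 0)).Local v)).1.val.val : Matrix (Fin 2) (Fin 2) (LocalRing L v)) * P.val) 1 1)])
    (K : Subgroup ((cmDatum L 2 (Matrix.of fun i j : Fin 2 => if i.val + j.val + 1 = 2 then (1 : L) else 0)).Local v)) (hK : ∀ g, g ∈ K ↔ E₂ g ∈ ((glInt 2 (w.1.adicCompletion L)).subgroupOf (unitaryGroupOfForm (galAdicCompletionMap (L := L) (IsCMField.complexConj L) hw) (placeForm (Matrix.of fun i j : Fin 2 => if i.val + j.val + 1 = 2 then (1 : L) else 0) w.1)))) (hKo : IsOpen (K : Set ((cmDatum L 2 (Matrix.of fun i j : Fin 2 => if i.val + j.val + 1 = 2 then (1 : L) else 0)).Local v))) (hKc : IsCompact (K : Set ((cmDatum L 2 (Matrix.of fun i j : Fin 2 => if i.val + j.val + 1 = 2 then (1 : L) else 0)).Local v)))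
    (φ : ((cmDatum L 2 (Matrix.of fun i j : Fin 2 => if i.val + j.val + 1 = 2 then (1 : L) else 0)).Local v × (cmDatum L 1 (Matrix.of fun i j : Fin 1 => if i.val + j.val + 1 = 1 then (1 : L) else 0)).Local v) → ℂ) (hφs : tsupport φ ⊆ (((K).prod (⊤ : Subgroup ((cmDatum L 1 (Matrix.of fun i j : Fin 1 => if i.val + j.val + 1 = 1 then (1 : L) else 0)).Local v)) : Subgroup ((cmDatum L 2 (Matrix.of fun i j : Fin 2 => if i.val + j.val + 1 = 2 then (1 : L) else 0)).Local v × (cmDatum L 1 (Matrix.of fun i j : Fin 1 => if i.val + j.val + 1 = 1 then (1 : L) else 0)).Local v)) : Set ((cmDatum L 2 (Matrix.of fun i j : Fin 2 => if i.val + j.val + 1 = 2 then (1 : L) else 0)).Local v × (cmDatum L 1 (Matrix.of fun i j : Fin 1 => if i.val + j.val + 1 = 1 then (1 : L) else 0)).Local v))) (hφK : ∀ u ∈ (K.prod (⊤ : Subgroup ((cmDatum L 1 (Matrix.of fun i j : Fin 1 => if i.val + j.val + 1 = 1 then (1 : L) else 0)).Local v)) : Subgroup ((cmDatum L 2 (Matrix.of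 fun i j : Fin 2 => if i.val + j.val + 1 = 2 then (1 : L) else 0)).Local v × (cmDatum L 1 (Matrix.of fun i j : Fin 1 => if i.val + j.val + 1 = 1 then (1 : L) else 0)).Local v)), ∀ x, φ (u * x * u⁻¹) = φ x)
    (m : ℕ) (Km : Subgroup ↥(unitaryGroupOfForm (galAdicCompletionMap (L := L) (IsCMField.complexConj L) hw) (placeForm (Matrix.of fun i j : Fin 2 => if i.val + j.val + 1 = 2 then (1 : L) else 0) w.1))) (hKm : ∀ y : ↥(unitaryGroupOfForm (galAdicCompletionMap (L := L) (IsCMField.complexConj L) hw) (placeForm (Matrix.of fun i j : Fin 2 => if i.val + j.val + 1 = 2 then (1 : L) else 0) w.1)), (∀ r s, (toPlace v w (HeckeCharacter.uniformizer ↥(maximalRealSubfield L) v : v.adicCompletion ↥(maximalRealSubfield L))) ^ (-(m : ℤ)) * ((((y : ↥(unitaryGroupOfForm (galAdicCompletionMap (L := L) (IsCMField.complexConj L) hw) (placeForm (Matrix.of fun i j : Fin 2 => if i.val + j.val + 1 = 2 then (1 : L) else 0) w.1))) : GL (Fin 2) (w.1.adicCompletion L)) : Matrix (Fin 2) (Fin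 2) (w.1.adicCompletion L)) - 1) r s ∈ 𝒪[(w.1.adicCompletion L)]) → y ∈ Km)
    (hφm : ∀ (a : (cmDatum L 1 (Matrix.of fun i j : Fin 1 => if i.val + j.val + 1 = 1 then (1 : L) else 0)).Local v) (x' : ↥(unitaryGroupOfForm (galAdicCompletionMap (L := L) (IsCMField.complexConj L) hw) (placeForm (Matrix.of fun i j : Fin 2 => if i.val + j.val + 1 = 2 then (1 : L) else 0) w.1))), ∀ y ∈ Km, φ (E₂.symm (x' * y), a) = φ (E₂.symm x', a))
    (xm : ↥(Subgroup.centralizer ({t₀} : Set ((cmDatum L 2 (Matrix.of fun i j : Fin 2 => if i.val + j.val + 1 = 2 then (1 : L) else 0)).Local v × (cmDatum L 1 (Matrix.of fun i j : Fin 1 => if i.val + j.val + 1 = 1 then (1 : L) else 0)).Local v))) → ↥(unitaryGroupOfForm (galAdicCompletionMap (L := L) (IsCMField.complexConj L) hw) (placeForm (Matrix.of fun i j : Fin 2 => if i.val + j.val + 1 = 2 then (1 : L) else 0) w.1))) (hxm : ∀ t, (((xm t : ↥(unitaryGroupOfForm (galAdicCompletionMap (L := L) (IsCMField.complexConj L)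 hw) (placeForm (Matrix.of fun i j : Fin 2 => if i.val + j.val + 1 = 2 then (1 : L) else 0) w.1))) : GL (Fin 2) (w.1.adicCompletion L)) : Matrix (Fin 2) (Fin 2) (w.1.adicCompletion L)) = ((((P⁻¹).val * ((t : ((cmDatum L 2 (Matrix.of fun i j : Fin 2 => if i.val + j.val + 1 = 2 then (1 : L) else 0)).Local v × (cmDatum L 1 (Matrix.of fun i j : Fin 1 => if i.val + j.val + 1 = 1 then (1 : L) else 0)).Local v)).1.val.val : Matrix (Fin 2) (Fin 2) (LocalRing L v)) * P.val) 1 1) w) • (1 : Matrix (Fin 2) (Fin 2) (w.1.adicCompletion L)))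
    (xs : ↥(Subgroup.centralizer ({t₀} : Set ((cmDatum L 2 (Matrix.of fun i j : Fin 2 => if i.val + j.val + 1 = 2 then (1 : L) else 0)).Local v × (cmDatum L 1 (Matrix.of fun i j : Fin 1 => if i.val + j.val + 1 = 1 then (1 : L) else 0)).Local v))) → ℕ → ↥(unitaryGroupOfForm (galAdicCompletionMap (L := L) (IsCMField.complexConj L) hw) (placeForm (Matrix.of fun i j : Fin 2 => if i.val + j.val + 1 = 2 then (1 : L) else 0) w.1))) (hxs : ∀ t i, (((xs t i : ↥(unitaryGroupOfForm (galAdicCompletionMap (L := L) (IsCMField.complexConj L) hw) (placeForm (Matrix.of fun i j : Fin 2 => if i.val + j.val + 1 = 2 then (1 : L) else 0) w.1))) : GL (Fin 2) (w.1.adicCompletion L)) : Matrix (Fin 2) (Fin 2) (w.1.adicCompletion L)) = ((((P⁻¹).val * ((t : ((cmDatum L 2 (Matrix.of fun i j : Fin 2 => if i.val + j.val + 1 = 2 then (1 : L) else 0)).Local v × (cmDatum L 1 (Matrix.of fun i j : Fin 1 => if i.val + j.val + 1 = 1 then (1 : L) else 0)).Local v)).1.val.val : Matrix (Fin 2) (Fin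 2) (LocalRing L v)) * P.val) 1 1) w) • ((1 : Matrix (Fin 2) (Fin 2) (w.1.adicCompletion L)) + (toPlace v w (HeckeCharacter.uniformizer ↥(maximalRealSubfield L) v : v.adicCompletion ↥(maximalRealSubfield L))) ^ i • !![0, ((σO a₀ - a₀ : 𝒪[(w.1.adicCompletion L)]) : (w.1.adicCompletion L)); 0, 0]))
    {b : ℕ} (hb : b ≤ 1) (hbpar : Even (WithZero.log (Valued.v (twistGram (galAdicCompletionMap (L := L) (IsCMField.complexConj L) hw) (placeForm (Matrix.of fun i j : Fin 2 => if i.val + j.val + 1 = 2 then (1 : L) else 0) w.1) ((((Matrix.GeneralLinearGroup.map (Pi.evalRingHom (fun w' : PlacesOver L v => w'.1.adicCompletion L) w) P)) : GL (Fin 2) (w.1.adicCompletion L)) : Matrix (Fin 2) (Fin 2) (w.1.adicCompletion L)) 0 0))) ↔ b = 0)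
    (t : ↥(Subgroup.centralizer ({t₀} : Set ((cmDatum L 2 (Matrix.of fun i j : Fin 2 => if i.val + j.val + 1 = 2 then (1 : L) else 0)).Local v × (cmDatum L 1 (Matrix.of fun i j : Fin 1 => if i.val + j.val + 1 = 1 then (1 : L) else 0)).Local v)))) (hreg : IsRegularElt (((t : ((cmDatum L 2 (Matrix.of fun i j : Fin 2 => if i.val + j.val + 1 = 2 then (1 : L) else 0)).Local v × (cmDatum L 1 (Matrix.of fun i j : Fin 1 => if i.val + j.val + 1 = 1 then (1 : L) else 0)).Local v))).1.val : GL (Fin 2) (LocalRing L v))) (hmN : m ≤ (-WithZero.log (Valued.v ((((P⁻¹).val * ((t : ((cmDatum L 2 (Matrix.of fun i j : Fin 2 => if i.val + j.val + 1 = 2 then (1 : L) else 0)).Local v × (cmDatum L 1 (Matrix.of fun i j : Fin 1 => if i.val + j.val + 1 = 1 then (1 : L) else 0)).Local v)).1.val.val : Matrix (Fin 2) (Fin 2) (LocalRing L v)) * P.val) 0 0 - ((P⁻¹).val * ((t : ((cmDatum L 2 (Matrix.of fun i j : Fin 2 => if i.val + j.val + 1 = 2 then (1 : L) else 0)).Local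 v × (cmDatum L 1 (Matrix.of fun i j : Fin 1 => if i.val + j.val + 1 = 1 then (1 : L) else 0)).Local v)).1.val.val : Matrix (Fin 2) (Fin 2) (LocalRing L v)) * P.val) 1 1) w))).toNat) :
    (∫ y, φ (y * (t : ((cmDatum L 2 (Matrix.of fun i j : Fin 2 => if i.val + j.val + 1 = 2 then (1 : L) else 0)).Local v × (cmDatum L 1 (Matrix.of fun i j : Fin 1 => if i.val + j.val + 1 = 1 then (1 : L) else 0)).Local v)) * y⁻¹) ∂ν) +
    (∫ y, φ (y * e (t : ((cmDatum L 2 (Matrix.of fun i j : Fin 2 => if i.val + j.val + 1 = 2 then (1 : L) else 0)).Local v × (cmDatum L 1 (Matrix.of fun i j : Fin 1 => if i.val + j.val + 1 = 1 then (1 : L) else 0)).Local v)) * y⁻¹) ∂ν) = ν.real (((K).prod (⊤ : Subgroup ((cmDatum L 1 (Matrix.of fun i j : Fin 1 => if i.val + j.val + 1 = 1 then (1 : L) else 0)).Local v)) : Subgroup ((cmDatum L 2 (Matrix.of fun i j : Fin 2 => if i.val + j.val + 1 = 2 then (1 : L) else 0)).Local v × (cmDatum L 1 (Matrix.of fun i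 j : Fin 1 => if i.val + j.val + 1 = 1 then (1 : L) else 0)).Local v)) : Set ((cmDatum L 2 (Matrix.of fun i j : Fin 2 => if i.val + j.val + 1 = 2 then (1 : L) else 0)).Local v × (cmDatum L 1 (Matrix.of fun i j : Fin 1 => if i.val + j.val + 1 = 1 then (1 : L) else 0)).Local v)) •
        ((∑ j ∈ Finset.range ((-WithZero.log (Valued.v ((((P⁻¹).val * ((t : ((cmDatum L 2 (Matrix.of fun i j : Fin 2 => if i.val + j.val + 1 = 2 then (1 : L) else 0)).Local v × (cmDatum L 1 (Matrix.of fun i j : Fin 1 => if i.val + j.val + 1 = 1 then (1 : L) else 0)).Local v)).1.val.val : Matrix (Fin 2) (Fin 2) (LocalRing L v)) * P.val) 0 0 - ((P⁻¹).val * ((t : ((cmDatum L 2 (Matrix.of fun i j : Fin 2 => if i.val + j.val + 1 = 2 then (1 : L) else 0)).Local v × (cmDatum L 1 (Matrix.of fun i j : Fin 1 => if i.val + j.val + 1 = 1 then (1 : L) else 0)).Local v)).1.val.val : Matrix (Fin 2) (Fin 2) (LocalRing L v)) * P.val) 1 1) w))).toNat - m + 1), (if j = 0 then 1 else (Nat.card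 (𝓞 ↥(maximalRealSubfield L) ⧸ v.asIdeal)) ^ (j - 1) * ((Nat.card (𝓞 ↥(maximalRealSubfield L) ⧸ v.asIdeal)) + 1))) • φ (E₂.symm (xm t), ((t : ((cmDatum L 2 (Matrix.of fun i j : Fin 2 => if i.val + j.val + 1 = 2 then (1 : L) else 0)).Local v × (cmDatum L 1 (Matrix.of fun i j : Fin 1 => if i.val + j.val + 1 = 1 then (1 : L) else 0)).Local v))).2) + ∑ i ∈ Finset.range m, (if ((-WithZero.log (Valued.v ((((P⁻¹).val * ((t : ((cmDatum L 2 (Matrix.of fun i j : Fin 2 => if i.val + j.val + 1 = 2 then (1 : L) else 0)).Local v × (cmDatum L 1 (Matrix.of fun i j : Fin 1 => if i.val + j.val + 1 = 1 then (1 : L) else 0)).Local v)).1.val.val : Matrix (Fin 2) (Fin 2) (LocalRing L v)) * P.val) 0 0 - ((P⁻¹).val * ((t : ((cmDatum L 2 (Matrix.of fun i j : Fin 2 => if i.val + j.val + 1 = 2 then (1 : L) else 0)).Local v × (cmDatum L 1 (Matrix.of fun i j : Fin 1 => if i.val + j.val + 1 = 1 then (1 : L) else 0)).Local v)).1.val.val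 : Matrix (Fin 2) (Fin 2) (LocalRing L v)) * P.val) 1 1) w))).toNat - i) = 0 then 1 else (Nat.card (𝓞 ↥(maximalRealSubfield L) ⧸ v.asIdeal)) ^ (((-WithZero.log (Valued.v ((((P⁻¹).val * ((t : ((cmDatum L 2 (Matrix.of fun i j : Fin 2 => if i.val + j.val + 1 = 2 then (1 : L) else 0)).Local v × (cmDatum L 1 (Matrix.of fun i j : Fin 1 => if i.val + j.val + 1 = 1 then (1 : L) else 0)).Local v)).1.val.val : Matrix (Fin 2) (Fin 2) (LocalRing L v)) * P.val) 0 0 - ((P⁻¹).val * ((t : ((cmDatum L 2 (Matrix.of fun i j : Fin 2 => if i.val + j.val + 1 = 2 then (1 : L) else 0)).Local v × (cmDatum L 1 (Matrix.of fun i j : Fin 1 => if i.val + j.val + 1 = 1 then (1 : L) else 0)).Local v)).1.val.val : Matrix (Fin 2) (Fin 2) (LocalRing L v)) * P.val) 1 1) w))).toNat - i) - 1) * ((Nat.card (𝓞 ↥(maximalRealSubfield L) ⧸ v.asIdeal)) + 1)) • φ (E₂.symm (xs t i), ((t : ((cmDatum L 2 (Matrix.of fun i j : Fin 2 => if i.val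 + j.val + 1 = 2 then (1 : L) else 0)).Local v × (cmDatum L 1 (Matrix.of fun i j : Fin 1 => if i.val + j.val + 1 = 1 then (1 : L) else 0)).Local v))).2)) := by
  obtain ⟨h₁, h₂⟩ := depthExpansion_pair_selfDual L v w hw hunr ν t₀ P d ht₀ hP hd1 σO hσO' hσσ ha₀ E₂ hE₂ hr₀ e he2 heframe K hK hKo hKc φ hφs hφK m Km hKm hφm xm hxm xs hxs hb hbpar t hreg hmN
  rw [h₁, h₂, ← smul_add]
  congr 1
  exact paritySum_smul_add_paritySum_smul_eq (Nat.card (𝓞 ↥(maximalRealSubfield L) ⧸ v.asIdeal)) hmN hb (φ (E₂.symm (xm t), ((t : ((cmDatum L 2 (Matrix.of fun i j : Fin 2 => if i.val + j.val + 1 = 2 then (1 : L) else 0)).Local v × (cmDatum L 1 (Matrix.of fun i j : Fin 1 => if i.val + j.val + 1 = 1 then (1 : L) else 0)).Local v))).2)) (fun i => φ (E₂.symm (xs t i), ((t : ((cmDatum L 2 (Matrix.of fun i j : Fin 2 => if i.val + j.val + 1 = 2 then (1 : L) else 0)).Local v × (cmDatum L 1 (Matrix.of fun i j : Fin 1 =>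 if i.val + j.val + 1 = 1 then (1 : L) else 0)).Local v))).2))

-- `L_w`-sized statement: elaboration budget only (no search)
set_option maxHeartbeats 1600000 in
include hw hunr ht₀ hP hd1 in
/-- **THE STABLE DEPTH EXPANSION, `ϖ`-MODULAR VERTEX TYPE (`ε = 1`).**  As `integral_conj_add_integral_conj_partner_eq_selfDual` with `K ↔ K¹ = Ad(D_ϖ) GL₂(𝒪_w) ∩ U_w`
and the level hypothesis conjugated (binders of ★ `depthExpansion_pair_modular` VERBATIM).
[cite: Rogawski1990, §4.9 Lemma 4.9.3 p. 56; §8.1 Prop. 8.1.1 p. 112] [cite: LabesseLanglands1979, §2, §5] [cite: Kottwitz1988, §2] -/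
theorem integral_conj_add_integral_conj_partner_eq_modular
    (σO : 𝒪[(w.1.adicCompletion L)] →+* 𝒪[(w.1.adicCompletion L)]) (hσO' : ∀ x : 𝒪[(w.1.adicCompletion L)], ((σO x : 𝒪[(w.1.adicCompletion L)]) : (w.1.adicCompletion L)) = (galAdicCompletionMap (L := L) (IsCMField.complexConj L) hw) x) (hσσ : ∀ x, σO (σO x) = x)
    {a₀ : 𝒪[(w.1.adicCompletion L)]} (ha₀ : IsUnit (σO a₀ - a₀))
    (E₂ : (cmDatum L 2 (Matrix.of fun i j : Fin 2 => if i.val + j.val + 1 = 2 then (1 : L) else 0)).Local v ≃ₜ* ↥(unitaryGroupOfForm (galAdicCompletionMap (L := L) (IsCMField.complexConj L) hw) (placeForm (Matrix.of fun i j : Fin 2 => if i.val + j.val + 1 = 2 then (1 : L) else 0) w.1))) (hE₂ : ∀ g, ((E₂ g : ↥(unitaryGroupOfForm (galAdicCompletionMap (L := L) (IsCMField.complexConj L) hw) (placeForm (Matrix.of fun i j : Fin 2 => if i.val + j.val + 1 = 2 then (1 : L) else 0) w.1))) : GL (Fin 2) (w.1.adicCompletion L)) = ((localNonsplitEquiv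 (IsCMField.complexConj L) (Matrix.of fun i j : Fin 2 => if i.val + j.val + 1 = 2 then (1 : L) else 0) (IsCMField.complexConj_ne_one L) w hw g : ↥(unitaryGroupOfForm (galAdicCompletionMap (L := L) (IsCMField.complexConj L) hw) (placeForm (Matrix.of fun i j : Fin 2 => if i.val + j.val + 1 = 2 then (1 : L) else 0) w.1))) : GL (Fin 2) (w.1.adicCompletion L)))
    (hr₀ : IsUnit (toLocalRing L v (HeckeCharacter.uniformizer ↥(maximalRealSubfield L) v : v.adicCompletion ↥(maximalRealSubfield L)))) (e : ((cmDatum L 2 (Matrix.of fun i j : Fin 2 => if i.val + j.val + 1 = 2 then (1 : L) else 0)).Local v × (cmDatum L 1 (Matrix.of fun i j : Fin 1 => if i.val + j.val + 1 = 1 then (1 : L) else 0)).Local v) ≃ₜ* ((cmDatum L 2 (Matrix.of fun i j : Fin 2 => if i.val + j.val + 1 = 2 then (1 : L) else 0)).Local v × (cmDatum L 1 (Matrix.of fun i j : Fin 1 => if i.val + j.val + 1 = 1 then (1 : L) else 0)).Local v)) (he2 : ∀ a : ((cmDatum L 2 (Matrix.of fun i j : Fin 2 => if i.val + j.val + 1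 = 2 then (1 : L) else 0)).Local v × (cmDatum L 1 (Matrix.of fun i j : Fin 1 => if i.val + j.val + 1 = 1 then (1 : L) else 0)).Local v), (e a).2 = a.2)
    (heframe : ∀ t : ↥(Subgroup.centralizer ({t₀} : Set ((cmDatum L 2 (Matrix.of fun i j : Fin 2 => if i.val + j.val + 1 = 2 then (1 : L) else 0)).Local v × (cmDatum L 1 (Matrix.of fun i j : Fin 1 => if i.val + j.val + 1 = 1 then (1 : L) else 0)).Local v))), ((e (t : ((cmDatum L 2 (Matrix.of fun i j : Fin 2 => if i.val + j.val + 1 = 2 then (1 : L) else 0)).Local v × (cmDatum L 1 (Matrix.of fun i j : Fin 1 => if i.val + j.val + 1 = 1 then (1 : L) else 0)).Local v))).1.val.val : Matrix (Fin 2) (Fin 2) (LocalRing L v)) * ((glDiagonal 2 (LocalRing L v) ![1, hr₀.unit]) * P).val = ((glDiagonal 2 (LocalRing L v) ![1, hr₀.unit]) * P).val * Matrix.diagonal ![(((P⁻¹).val * ((t : ((cmDatum L 2 (Matrix.of fun i j : Fin 2 => if i.val + j.val + 1 = 2 then (1 : L) else 0)).Local v × (cmDatum L 1 (Matrix.of fun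 i j : Fin 1 => if i.val + j.val + 1 = 1 then (1 : L) else 0)).Local v)).1.val.val : Matrix (Fin 2) (Fin 2) (LocalRing L v)) * P.val) 0 0), (((P⁻¹).val * ((t : ((cmDatum L 2 (Matrix.of fun i j : Fin 2 => if i.val + j.val + 1 = 2 then (1 : L) else 0)).Local v × (cmDatum L 1 (Matrix.of fun i j : Fin 1 => if i.val + j.val + 1 = 1 then (1 : L) else 0)).Local v)).1.val.val : Matrix (Fin 2) (Fin 2) (LocalRing L v)) * P.val) 1 1)])
    (K : Subgroup ((cmDatum L 2 (Matrix.of fun i j : Fin 2 => if i.val + j.val + 1 = 2 then (1 : L) else 0)).Local v)) (hK : ∀ g, g ∈ K ↔ E₂ g ∈ (((glInt 2 (w.1.adicCompletion L)).map (MulAut.conj (glDiagonal 2 (w.1.adicCompletion L) ![1, Units.mk0 (toPlace v w (HeckeCharacter.uniformizer ↥(maximalRealSubfield L) v : v.adicCompletion ↥(maximalRealSubfield L))) (toPlace_uniformizer_ne_zero L v w hunr)])).toMonoidHom).subgroupOf (unitaryGroupOfForm (galAdicCompletionMap (L := L) (IsCMField.complexConj L) hw) (placeForm (Matrix.of fun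 i j : Fin 2 => if i.val + j.val + 1 = 2 then (1 : L) else 0) w.1)))) (hKo : IsOpen (K : Set ((cmDatum L 2 (Matrix.of fun i j : Fin 2 => if i.val + j.val + 1 = 2 then (1 : L) else 0)).Local v))) (hKc : IsCompact (K : Set ((cmDatum L 2 (Matrix.of fun i j : Fin 2 => if i.val + j.val + 1 = 2 then (1 : L) else 0)).Local v)))
    (φ : ((cmDatum L 2 (Matrix.of fun i j : Fin 2 => if i.val + j.val + 1 = 2 then (1 : L) else 0)).Local v × (cmDatum L 1 (Matrix.of fun i j : Fin 1 => if i.val + j.val + 1 = 1 then (1 : L) else 0)).Local v) → ℂ) (hφs : tsupport φ ⊆ (((K).prod (⊤ : Subgroup ((cmDatum L 1 (Matrix.of fun i j : Fin 1 => if i.val + j.val + 1 = 1 then (1 : L) else 0)).Local v)) : Subgroup ((cmDatum L 2 (Matrix.of fun i j : Fin 2 => if i.val + j.val + 1 = 2 then (1 : L) else 0)).Local v × (cmDatum L 1 (Matrix.of fun i j : Fin 1 => if i.val + j.val + 1 = 1 then (1 : L) else 0)).Local v)) : Set ((cmDatum L 2 (Matrix.of fun i j : Fin 2 => if i.val + j.val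 + 1 = 2 then (1 : L) else 0)).Local v × (cmDatum L 1 (Matrix.of fun i j : Fin 1 => if i.val + j.val + 1 = 1 then (1 : L) else 0)).Local v))) (hφK : ∀ u ∈ (K.prod (⊤ : Subgroup ((cmDatum L 1 (Matrix.of fun i j : Fin 1 => if i.val + j.val + 1 = 1 then (1 : L) else 0)).Local v)) : Subgroup ((cmDatum L 2 (Matrix.of fun i j : Fin 2 => if i.val + j.val + 1 = 2 then (1 : L) else 0)).Local v × (cmDatum L 1 (Matrix.of fun i j : Fin 1 => if i.val + j.val + 1 = 1 then (1 : L) else 0)).Local v)), ∀ x, φ (u * x * u⁻¹) = φ x)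
    (m : ℕ) (Km : Subgroup ↥(unitaryGroupOfForm (galAdicCompletionMap (L := L) (IsCMField.complexConj L) hw) (placeForm (Matrix.of fun i j : Fin 2 => if i.val + j.val + 1 = 2 then (1 : L) else 0) w.1)))
    (hKm : ∀ y : ↥(unitaryGroupOfForm (galAdicCompletionMap (L := L) (IsCMField.complexConj L) hw) (placeForm (Matrix.of fun i j : Fin 2 => if i.val + j.val + 1 = 2 then (1 : L) else 0) w.1)), (∀ r s, (toPlace v w (HeckeCharacter.uniformizer ↥(maximalRealSubfield L) v : v.adicCompletion ↥(maximalRealSubfield L))) ^ (-(m : ℤ)) * (((((glDiagonal 2 (w.1.adicCompletion L) ![1, Units.mk0 (toPlace v w (HeckeCharacter.uniformizer ↥(maximalRealSubfield L) v : v.adicCompletion ↥(maximalRealSubfield L))) (toPlace_uniformizer_ne_zero L v w hunr)])⁻¹ * ((y : ↥(unitaryGroupOfForm (galAdicCompletionMap (L := L) (IsCMField.complexConj L) hw) (placeForm (Matrix.of fun i j : Fin 2 => if i.val + j.val + 1 = 2 then (1 : L) else 0) w.1))) : GL (Fin 2) (w.1.adicCompletion L)) * (glDiagonal 2 (w.1.adicCompletion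 L) ![1, Units.mk0 (toPlace v w (HeckeCharacter.uniformizer ↥(maximalRealSubfield L) v : v.adicCompletion ↥(maximalRealSubfield L))) (toPlace_uniformizer_ne_zero L v w hunr)]) : GL (Fin 2) (w.1.adicCompletion L))) : Matrix (Fin 2) (Fin 2) (w.1.adicCompletion L)) - 1) r s ∈ 𝒪[(w.1.adicCompletion L)]) → y ∈ Km)
    (hφm : ∀ (a : (cmDatum L 1 (Matrix.of fun i j : Fin 1 => if i.val + j.val + 1 = 1 then (1 : L) else 0)).Local v) (x' : ↥(unitaryGroupOfForm (galAdicCompletionMap (L := L) (IsCMField.complexConj L) hw) (placeForm (Matrix.of fun i j : Fin 2 => if i.val + j.val + 1 = 2 then (1 : L) else 0) w.1))), ∀ y ∈ Km, φ (E₂.symm (x' * y), a) = φ (E₂.symm x', a))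
    (xm : ↥(Subgroup.centralizer ({t₀} : Set ((cmDatum L 2 (Matrix.of fun i j : Fin 2 => if i.val + j.val + 1 = 2 then (1 : L) else 0)).Local v × (cmDatum L 1 (Matrix.of fun i j : Fin 1 => if i.val + j.val + 1 = 1 then (1 : L) else 0)).Local v))) → ↥(unitaryGroupOfForm (galAdicCompletionMap (L := L) (IsCMField.complexConj L) hw) (placeForm (Matrix.of fun i j : Fin 2 => if i.val + j.val + 1 = 2 then (1 : L) else 0) w.1))) (hxm : ∀ t, (((xm t : ↥(unitaryGroupOfForm (galAdicCompletionMap (L := L) (IsCMField.complexConj L) hw) (placeForm (Matrix.of fun i j : Fin 2 => if i.val + j.val + 1 = 2 then (1 : L) else 0) w.1))) : GL (Fin 2) (w.1.adicCompletion L)) : Matrix (Fin 2) (Fin 2) (w.1.adicCompletion L)) = ((((P⁻¹).val * ((t : ((cmDatum L 2 (Matrix.of fun i j : Fin 2 => if i.val + j.val + 1 = 2 then (1 : L) else 0)).Local v × (cmDatum L 1 (Matrix.of fun i j : Fin 1 => if i.val + j.val + 1 = 1 then (1 : L) else 0)).Local v)).1.val.val : Matrix (Fin 2) (Fin 2) (LocalRing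 L v)) * P.val) 1 1) w) • (1 : Matrix (Fin 2) (Fin 2) (w.1.adicCompletion L)))
    (xs : ↥(Subgroup.centralizer ({t₀} : Set ((cmDatum L 2 (Matrix.of fun i j : Fin 2 => if i.val + j.val + 1 = 2 then (1 : L) else 0)).Local v × (cmDatum L 1 (Matrix.of fun i j : Fin 1 => if i.val + j.val + 1 = 1 then (1 : L) else 0)).Local v))) → ℕ → ↥(unitaryGroupOfForm (galAdicCompletionMap (L := L) (IsCMField.complexConj L) hw) (placeForm (Matrix.of fun i j : Fin 2 => if i.val + j.val + 1 = 2 then (1 : L) else 0) w.1))) (hxs : ∀ t i, (((xs t i : ↥(unitaryGroupOfForm (galAdicCompletionMap (L := L) (IsCMField.complexConj L) hw) (placeForm (Matrix.of fun i j : Fin 2 => if i.val + j.val + 1 = 2 then (1 : L) else 0) w.1))) : GL (Fin 2) (w.1.adicCompletion L)) : Matrix (Fin 2) (Fin 2) (w.1.adicCompletion L)) = ((((P⁻¹).val * ((t : ((cmDatum L 2 (Matrix.of fun i j : Fin 2 => if i.val + j.val + 1 = 2 then (1 : L) else 0)).Local v × (cmDatum L 1 (Matrix.of fun i j : Fin 1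 => if i.val + j.val + 1 = 1 then (1 : L) else 0)).Local v)).1.val.val : Matrix (Fin 2) (Fin 2) (LocalRing L v)) * P.val) 1 1) w) • ((1 : Matrix (Fin 2) (Fin 2) (w.1.adicCompletion L)) + ((toPlace v w (HeckeCharacter.uniformizer ↥(maximalRealSubfield L) v : v.adicCompletion ↥(maximalRealSubfield L))) ^ i * ((toPlace v w (HeckeCharacter.uniformizer ↥(maximalRealSubfield L) v : v.adicCompletion ↥(maximalRealSubfield L))))⁻¹) • !![0, ((σO a₀ - a₀ : 𝒪[(w.1.adicCompletion L)]) : (w.1.adicCompletion L)); 0, 0]))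
    {b : ℕ} (hb : b ≤ 1) (hbpar : Even (WithZero.log (Valued.v (twistGram (galAdicCompletionMap (L := L) (IsCMField.complexConj L) hw) (placeForm (Matrix.of fun i j : Fin 2 => if i.val + j.val + 1 = 2 then (1 : L) else 0) w.1) ((((Matrix.GeneralLinearGroup.map (Pi.evalRingHom (fun w' : PlacesOver L v => w'.1.adicCompletion L) w) P)) : GL (Fin 2) (w.1.adicCompletion L)) : Matrix (Fin 2) (Fin 2) (w.1.adicCompletion L)) 0 0))) ↔ b = 1)
    (t : ↥(Subgroup.centralizer ({t₀} : Set ((cmDatum L 2 (Matrix.of fun i j : Fin 2 => if i.val + j.val + 1 = 2 then (1 : L) else 0)).Local v × (cmDatum L 1 (Matrix.of fun i j : Fin 1 => if i.val + j.val + 1 = 1 then (1 : L) else 0)).Local v)))) (hreg : IsRegularElt (((t : ((cmDatum L 2 (Matrix.of fun i j : Fin 2 => if i.val + j.val + 1 = 2 then (1 : L) else 0)).Local v × (cmDatum L 1 (Matrix.of fun i j : Fin 1 => if i.val + j.val + 1 = 1 then (1 : L) else 0)).Local v))).1.val : GL (Fin 2) (LocalRing L v))) (hmN : m ≤ (-WithZero.log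 (Valued.v ((((P⁻¹).val * ((t : ((cmDatum L 2 (Matrix.of fun i j : Fin 2 => if i.val + j.val + 1 = 2 then (1 : L) else 0)).Local v × (cmDatum L 1 (Matrix.of fun i j : Fin 1 => if i.val + j.val + 1 = 1 then (1 : L) else 0)).Local v)).1.val.val : Matrix (Fin 2) (Fin 2) (LocalRing L v)) * P.val) 0 0 - ((P⁻¹).val * ((t : ((cmDatum L 2 (Matrix.of fun i j : Fin 2 => if i.val + j.val + 1 = 2 then (1 : L) else 0)).Local v × (cmDatum L 1 (Matrix.of fun i j : Fin 1 => if i.val + j.val + 1 = 1 then (1 : L) else 0)).Local v)).1.val.val : Matrix (Fin 2) (Fin 2) (LocalRing L v)) * P.val) 1 1) w))).toNat) :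
    (∫ y, φ (y * (t : ((cmDatum L 2 (Matrix.of fun i j : Fin 2 => if i.val + j.val + 1 = 2 then (1 : L) else 0)).Local v × (cmDatum L 1 (Matrix.of fun i j : Fin 1 => if i.val + j.val + 1 = 1 then (1 : L) else 0)).Local v)) * y⁻¹) ∂ν) +
    (∫ y, φ (y * e (t : ((cmDatum L 2 (Matrix.of fun i j : Fin 2 => if i.val + j.val + 1 = 2 then (1 : L) else 0)).Local v × (cmDatum L 1 (Matrix.of fun i j : Fin 1 => if i.val + j.val + 1 = 1 then (1 : L) else 0)).Local v)) * y⁻¹) ∂ν) = ν.real (((K).prod (⊤ : Subgroup ((cmDatum L 1 (Matrix.of fun i j : Fin 1 => if i.val + j.val + 1 = 1 then (1 : L) else 0)).Local v)) : Subgroup ((cmDatum L 2 (Matrix.of fun i j : Fin 2 => if i.val + j.val + 1 = 2 then (1 : L) else 0)).Local v × (cmDatum L 1 (Matrix.of fun i j : Fin 1 => if i.val + j.val + 1 = 1 then (1 : L) else 0)).Local v)) : Set ((cmDatum L 2 (Matrix.of fun i j : Fin 2 => if i.val + j.val + 1 = 2 then (1 : L) else 0)).Local v × (cmDatum L 1 (Matrix.of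 fun i j : Fin 1 => if i.val + j.val + 1 = 1 then (1 : L) else 0)).Local v)) •
        ((∑ j ∈ Finset.range ((-WithZero.log (Valued.v ((((P⁻¹).val * ((t : ((cmDatum L 2 (Matrix.of fun i j : Fin 2 => if i.val + j.val + 1 = 2 then (1 : L) else 0)).Local v × (cmDatum L 1 (Matrix.of fun i j : Fin 1 => if i.val + j.val + 1 = 1 then (1 : L) else 0)).Local v)).1.val.val : Matrix (Fin 2) (Fin 2) (LocalRing L v)) * P.val) 0 0 - ((P⁻¹).val * ((t : ((cmDatum L 2 (Matrix.of fun i j : Fin 2 => if i.val + j.val + 1 = 2 then (1 : L) else 0)).Local v × (cmDatum L 1 (Matrix.of fun i j : Fin 1 => if i.val + j.val + 1 = 1 then (1 : L) else 0)).Local v)).1.val.val : Matrix (Fin 2) (Fin 2) (LocalRing L v)) * P.val) 1 1) w))).toNat - m + 1), (if j = 0 then 1 else (Nat.card (𝓞 ↥(maximalRealSubfield L) ⧸ v.asIdeal)) ^ (j - 1) * ((Nat.card (𝓞 ↥(maximalRealSubfield L) ⧸ v.asIdeal)) + 1))) • φ (E₂.symm (xm t), ((t : ((cmDatum L 2 (Matrix.of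 fun i j : Fin 2 => if i.val + j.val + 1 = 2 then (1 : L) else 0)).Local v × (cmDatum L 1 (Matrix.of fun i j : Fin 1 => if i.val + j.val + 1 = 1 then (1 : L) else 0)).Local v))).2) + ∑ i ∈ Finset.range m, (if ((-WithZero.log (Valued.v ((((P⁻¹).val * ((t : ((cmDatum L 2 (Matrix.of fun i j : Fin 2 => if i.val + j.val + 1 = 2 then (1 : L) else 0)).Local v × (cmDatum L 1 (Matrix.of fun i j : Fin 1 => if i.val + j.val + 1 = 1 then (1 : L) else 0)).Local v)).1.val.val : Matrix (Fin 2) (Fin 2) (LocalRing L v)) * P.val) 0 0 - ((P⁻¹).val * ((t : ((cmDatum L 2 (Matrix.of fun i j : Fin 2 => if i.val + j.val + 1 = 2 then (1 : L) else 0)).Local v × (cmDatum L 1 (Matrix.of fun i j : Fin 1 => if i.val + j.val + 1 = 1 then (1 : L) else 0)).Local v)).1.val.val : Matrix (Fin 2) (Fin 2) (LocalRing L v)) * P.val) 1 1) w))).toNat - i) = 0 then 1 else (Nat.card (𝓞 ↥(maximalRealSubfield L) ⧸ v.asIdeal)) ^ (((-WithZero.log (Valued.v ((((P⁻¹).val *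 ((t : ((cmDatum L 2 (Matrix.of fun i j : Fin 2 => if i.val + j.val + 1 = 2 then (1 : L) else 0)).Local v × (cmDatum L 1 (Matrix.of fun i j : Fin 1 => if i.val + j.val + 1 = 1 then (1 : L) else 0)).Local v)).1.val.val : Matrix (Fin 2) (Fin 2) (LocalRing L v)) * P.val) 0 0 - ((P⁻¹).val * ((t : ((cmDatum L 2 (Matrix.of fun i j : Fin 2 => if i.val + j.val + 1 = 2 then (1 : L) else 0)).Local v × (cmDatum L 1 (Matrix.of fun i j : Fin 1 => if i.val + j.val + 1 = 1 then (1 : L) else 0)).Local v)).1.val.val : Matrix (Fin 2) (Fin 2) (LocalRing L v)) * P.val) 1 1) w))).toNat - i) - 1) * ((Nat.card (𝓞 ↥(maximalRealSubfield L) ⧸ v.asIdeal)) + 1)) • φ (E₂.symm (xs t i), ((t : ((cmDatum L 2 (Matrix.of fun i j : Fin 2 => if i.val + j.val + 1 = 2 then (1 : L) else 0)).Local v × (cmDatum L 1 (Matrix.of fun i j : Fin 1 => if i.val + j.val + 1 = 1 then (1 : L) else 0)).Local v))).2)) := by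
  obtain ⟨h₁, h₂⟩ := depthExpansion_pair_modular L v w hw hunr ν t₀ P d ht₀ hP hd1 σO hσO' hσσ ha₀ E₂ hE₂ hr₀ e he2 heframe K hK hKo hKc φ hφs hφK m Km hKm hφm xm hxm xs hxs hb hbpar t hreg hmN
  rw [h₁, h₂, ← smul_add]
  congr 1
  exact paritySum_smul_add_paritySum_smul_eq (Nat.card (𝓞 ↥(maximalRealSubfield L) ⧸ v.asIdeal)) hmN hb (φ (E₂.symm (xm t), ((t : ((cmDatum L 2 (Matrix.of fun i j : Fin 2 => if i.val + j.val + 1 = 2 then (1 : L) else 0)).Local v × (cmDatum L 1 (Matrix.of fun i j : Fin 1 => if i.val + j.val + 1 = 1 then (1 : L) else 0)).Local v))).2)) (fun i => φ (E₂.symm (xs t i), ((t : ((cmDatum L 2 (Matrix.of fun i j : Fin 2 => if i.val + j.val + 1 = 2 then (1 : L) else 0)).Local v × (cmDatum L 1 (Matrix.of fun i j : Fin 1 => if i.val + j.val + 1 = 1 then (1 : L) else 0)).Local v))).2))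

end Pair

end Literature.NumberTheory.Rogawski1990

end
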